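import Summits.PneNP.PneNP.Theorems.KarlinRubinMonotoneSufficesGreedyPaths

/-!
# Crux `MonotoneSuffices` (stmt-PneNP-18026), the GREEDY general detector — part 6: pools under planting

The planted input is `x = plant A z` (`A` a `k`-set, `z` the noise). Along the planted clique the pools are
`pool x T = (A ∖ T) ∪ {v ∉ A : v ~_z T}` for `T ⊆ A`:

* `mem_pool_plant_of_mem` — `A ∖ T ⊆ pool (plant A z) T`;
* `card_pool_plant_le` — `#pool (plant A z) T ≤ #A + #{v ∉ A : v ~_z T}`;
* `card_badNoise_le` — the noise inputs `z` for which SOME `T ⊆ A` with `#T < t` has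
  `2 (n - #A) 2^{-#T} ≤ #{v ∉ A : v ~_z T}` number at most `2^{#A} · 2^{#E} · exp(-(n - #A) 2^{-(t-1)}/4)`
  (union bound + the Chernoff upper tail `Room.card_cnt_ge_le` with `η = 1`);
* `card_runsInto_ge_of_good` — for every other `z` ("good"), part 2 applies with `B i = #A + 2n/2^i`:
  `(#A+1-t)^t (n^M)^t ≤ #{c : the run of c on plant A z succeeds inside A} · ∏_{i<t} 2 (#A + 2n/2^i)`,
  provided `n ≤ (#A+1-t) M` (enough candidates per level).
-/

set_option linter.dupNamespace false -- `Summit.PneNP.PneNP.…`: summit = sub-problem name (D-0017 single-conjunct layout)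

namespace Summit.PneNP.PneNP.Theorems.MonotoneSuffices.Greedy

open Finset Real
open Literature.Probability.RandomGraphs.PlantedClique
open Summit.PneNP.PneNP.Theorems.MonotoneSuffices.Room

variable {n t M : ℕ}

/-! ### Pools along the planted clique -/

/-- The rest of the planted clique lies in every pool of a subset of it. [folklore] -/
theorem mem_pool_plant_of_mem (A T : Finset (Fin n)) (hTA : T ⊆ A) (z : EdgeVec n) {v : Fin n} (hv : v ∈ A)
    (hvT : v ∉ T) : v ∈ pool (plant A z) T := by
  classical
  rw [mem_pool]
  refine ⟨hvT, fun e he => ?_⟩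
  obtain ⟨w, hw, hew⟩ := (mem_filter.1 he).2
  rw [plant_apply_eq, Bool.or_eq_true]
  refine Or.inr (decide_eq_true fun u hu => ?_)
  rw [hew, Sym2.mem_iff] at hu
  rcases hu with rfl | rfl
  · exact hv
  · exact hTA hw

/-- Outside the planted set, adjacency to `T ⊆ A` after planting is adjacency in the noise. [folklore] -/
theorem adjAll_plant_iff_of_not_mem (A T : Finset (Fin n)) (z : EdgeVec n) {v : Fin n} (hv : v ∉ A) :
    AdjAll (plant A z) T v ↔ AdjAll z T v := by
  classical
  refine forall₂_congr fun e he => ?_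
  obtain ⟨w, -, hew⟩ := (mem_filter.1 he).2
  have hnot : ¬ ∀ u ∈ (e : Sym2 (Fin n)), u ∈ A := fun h => hv (h v (by rw [hew]; exact Sym2.mem_mk_left v w))
  rw [plant_apply_eq, decide_eq_false hnot, Bool.or_false]

/-- **Pools along the planted clique are small when the noise is**:
`#pool (plant A z) T ≤ #A + #{v ∉ A : v ~_z T}`. [folklore] -/
theorem card_pool_plant_le (A T : Finset (Fin n)) (z : EdgeVec n) :
    #(pool (plant A z) T) ≤ #A + #((univ \ A).filter (AdjAll z T)) := by
  classical
  have hsub : pool (plant A z) T ⊆ A ∪ (univ \ A).filter (AdjAll z T) := by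
    intro v hv
    rw [mem_pool] at hv
    rw [mem_union]
    by_cases hvA : v ∈ A
    · exact Or.inl hvA
    · exact Or.inr (mem_filter.2 ⟨mem_sdiff.2 ⟨mem_univ _, hvA⟩, (adjAll_plant_iff_of_not_mem A T z hvA).1 hv.2⟩)
  exact (card_le_card hsub).trans (card_union_le _ _)

/-! ### Bad noise: some small subset of `A` has too many common neighbours outside `A` -/

/-- **The bad-noise count.** The noise inputs for which some `T ⊆ A` with `#T < t` has at least
`2 (n - #A) 2^{-#T}` common neighbours outside `A` number at most `2^{#A} · 2^{#E} · exp(-(n-#A) 2^{-(t-1)}/4)`.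
[folklore] -/
theorem card_badNoise_le (A : Finset (Fin n)) (t : ℕ) :
    (#((univ : Finset (EdgeVec n)).filter fun z => ∃ T ∈ A.powerset, #T < t ∧
        2 * (((n - #A : ℕ) : ℝ) * (2 : ℝ)⁻¹ ^ #T) ≤ #((univ \ A).filter (AdjAll z T))) : ℝ) ≤
      2 ^ #A * (2 ^ Fintype.card (⊤ : SimpleGraph (Fin n)).edgeSet *
        Real.exp (-((((n - #A : ℕ) : ℝ) * (2 : ℝ)⁻¹ ^ (t - 1)) / 4))) := by
  classical
  set I := A.powerset.filter fun T => #T < t with hI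
  -- the Chernoff events of the room theorem, one per small subset of `A`
  set E : Finset (Fin n) → Finset (EdgeVec n) := fun T => (univ : Finset (EdgeVec n)).filter fun z =>
    (1 + 1) * (#(univ \ A) * (2 : ℝ)⁻¹ ^ #T) ≤
      (#((univ \ A).filter fun u => ∀ e ∈ (univ.filter fun e : (⊤ : SimpleGraph (Fin n)).edgeSet =>
        ∃ w ∈ T, (e : Sym2 (Fin n)) = s(u, w)), z e = true) : ℝ) with hE
  have hU : (#(univ \ A) : ℝ) = ((n - #A : ℕ) : ℝ) := by rw [card_univ_sdiff, Fintype.card_fin]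
  have hsub : ((univ : Finset (EdgeVec n)).filter fun z => ∃ T ∈ A.powerset, #T < t ∧
      2 * (((n - #A : ℕ) : ℝ) * (2 : ℝ)⁻¹ ^ #T) ≤ #((univ \ A).filter (AdjAll z T))) ⊆ I.biUnion E := by
    intro z hz
    rw [mem_filter] at hz
    obtain ⟨-, T, hT, hTt, hle⟩ := hz
    rw [mem_biUnion]
    refine ⟨T, by rw [hI]; exact mem_filter.2 ⟨hT, hTt⟩, ?_⟩
    rw [hE, mem_filter]
    refine ⟨mem_univ _, ?_⟩
    have hle' : 2 * (((n - #A : ℕ) : ℝ) * (2 : ℝ)⁻¹ ^ #T) ≤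
        (#((univ \ A).filter fun u => ∀ e ∈ (univ.filter fun e : (⊤ : SimpleGraph (Fin n)).edgeSet =>
          ∃ w ∈ T, (e : Sym2 (Fin n)) = s(u, w)), z e = true) : ℝ) := hle
    rw [hU]
    linarith
  have hterm : ∀ T ∈ I, (#(E T) : ℝ) ≤ 2 ^ Fintype.card (⊤ : SimpleGraph (Fin n)).edgeSet *
      Real.exp (-((((n - #A : ℕ) : ℝ) * (2 : ℝ)⁻¹ ^ (t - 1)) / 4)) := by
    intro T hT
    rw [hI, mem_filter, mem_powerset] at hT
    obtain ⟨hTA, hTt⟩ := hT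
    have hUT : ∀ u ∈ univ \ A, u ∉ T := fun u hu h => (mem_sdiff.1 hu).2 (hTA h)
    have h := card_cnt_ge_le T (univ \ A) hUT (by norm_num : (0 : ℝ) ≤ 1) (by norm_num : (1 : ℝ) ≤ 2)
    refine h.trans (mul_le_mul_of_nonneg_left (Real.exp_le_exp.2 ?_) (by positivity))
    rw [hU]
    have hpow : (2 : ℝ)⁻¹ ^ (t - 1) ≤ (2 : ℝ)⁻¹ ^ #T :=
      pow_le_pow_of_le_one (by norm_num) (by norm_num) (by omega)
    have h0 : (0 : ℝ) ≤ ((n - #A : ℕ) : ℝ) := Nat.cast_nonneg _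
    nlinarith [mul_le_mul_of_nonneg_left hpow h0]
  have h1 : #((univ : Finset (EdgeVec n)).filter fun z => ∃ T ∈ A.powerset, #T < t ∧
      2 * (((n - #A : ℕ) : ℝ) * (2 : ℝ)⁻¹ ^ #T) ≤ #((univ \ A).filter (AdjAll z T))) ≤ ∑ T ∈ I, #(E T) :=
    (card_le_card hsub).trans card_biUnion_le
  have h1' : (#((univ : Finset (EdgeVec n)).filter fun z => ∃ T ∈ A.powerset, #T < t ∧
      2 * (((n - #A : ℕ) : ℝ) * (2 : ℝ)⁻¹ ^ #T) ≤ #((univ \ A).filter (AdjAll z T))) : ℝ) ≤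
      ∑ T ∈ I, (#(E T) : ℝ) := by exact_mod_cast h1
  have hIcard : (#I : ℝ) ≤ 2 ^ #A := by
    have h : #I ≤ 2 ^ #A := by rw [hI, ← card_powerset]; exact card_filter_le _ _
    exact_mod_cast h
  calc _ ≤ ∑ T ∈ I, (#(E T) : ℝ) := h1'
    _ ≤ ∑ _T ∈ I, 2 ^ Fintype.card (⊤ : SimpleGraph (Fin n)).edgeSet *
        Real.exp (-((((n - #A : ℕ) : ℝ) * (2 : ℝ)⁻¹ ^ (t - 1)) / 4)) := sum_le_sum hterm
    _ = #I * (2 ^ Fintype.card (⊤ : SimpleGraph (Fin n)).edgeSet *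
        Real.exp (-((((n - #A : ℕ) : ℝ) * (2 : ℝ)⁻¹ ^ (t - 1)) / 4))) := by rw [sum_const, nsmul_eq_mul]
    _ ≤ _ := mul_le_mul_of_nonneg_right hIcard (by positivity)

/-! ### Good noise: the threading count applies -/

/-- **Threading under good noise.** If for every `T ⊆ A` with `#T < t` the common neighbours of `T` in the
noise outside `A` are fewer than `2 (n - #A) 2^{-#T}`, and `n ≤ (#A+1-t) M`, then
`(#A+1-t)^t (n^M)^t ≤ #{c : ∃ T ⊆ A, run (plant A z) c t = some T} · ∏_{i<t} 2 (#A + 2n/2^i)`. [folklore] -/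
theorem card_runsInto_ge_of_good (A : Finset (Fin n)) (z : EdgeVec n) (t M : ℕ)
    (hgood : ∀ T ∈ A.powerset, #T < t →
      (#((univ \ A).filter (AdjAll z T)) : ℝ) < 2 * (((n - #A : ℕ) : ℝ) * (2 : ℝ)⁻¹ ^ #T))
    (hM : n ≤ (#A + 1 - t) * M) :
    (#A + 1 - t) ^ t * (n ^ M) ^ t ≤
      #((univ : Finset (Fin t → Fin M → Fin n)).filter fun c => ∃ T ⊆ A, run (plant A z) c t = some T) *
        ∏ i ∈ range t, (2 * (#A + 2 * n / 2 ^ i)) := by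
  classical
  refine card_runs_into_mul_ge (plant A z) A (fun i => #A + 2 * n / 2 ^ i) ?_ ?_ ?_
  · intro T hTA v hv hvT
    exact mem_pool_plant_of_mem A T hTA z hv hvT
  · intro T hTA hTt
    refine (card_pool_plant_le A T z).trans (Nat.add_le_add_left ?_ _)
    -- `cnt < 2 (n - #A) 2^{-#T} ≤ 2n / 2^{#T}`
    have h := hgood T (mem_powerset.2 hTA) hTt
    rw [Nat.le_div_iff_mul_le (by positivity)]
    have hreal : (#((univ \ A).filter (AdjAll z T)) : ℝ) * 2 ^ #T ≤ 2 * n := by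
      have h2 : (0 : ℝ) < 2 ^ #T := by positivity
      have hnk : ((n - #A : ℕ) : ℝ) ≤ n := by exact_mod_cast Nat.sub_le n #A
      have hinv : ((2 : ℝ)⁻¹ ^ #T) * 2 ^ #T = 1 := by rw [inv_pow, inv_mul_cancel₀ h2.ne']
      nlinarith [h, hinv, mul_le_mul_of_nonneg_right hnk (by positivity : (0 : ℝ) ≤ (2 : ℝ)⁻¹ ^ #T)]
    exact_mod_cast hreal
  · intro T hTA hTt
    -- the pool contains `A ∖ T`, of size `≥ #A + 1 - t`
    have hsub : A \ T ⊆ pool (plant A z) T := fun v hv =>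
      mem_pool_plant_of_mem A T hTA z (mem_sdiff.1 hv).1 (mem_sdiff.1 hv).2
    have hcard : #A + 1 - t ≤ #(pool (plant A z) T) := by
      refine le_trans ?_ (card_le_card hsub)
      rw [card_sdiff_of_subset hTA]
      omega
    exact hM.trans (Nat.mul_le_mul_right _ hcard)

end Summit.PneNP.PneNP.Theorems.MonotoneSuffices.Greedy

namespace Summit.PneNP.PneNP.Theorems.MonotoneSuffices.Greedy

open Finset

/-- Registered sub-goal `greedy_pools` of stmt-PneNP-18026 (greedy detector, part 6): threading under good
noise, exported verbatim. [folklore] -/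
theorem greedy_pools :
    ∀ {n : ℕ} (A : Finset (Fin n)) (z : Literature.Probability.RandomGraphs.PlantedClique.EdgeVec n) (t M : ℕ), (∀ T ∈ A.powerset, #T < t → (#((Finset.univ \ A).filter (Summit.PneNP.PneNP.Theorems.MonotoneSuffices.Greedy.AdjAll z T)) : ℝ) < 2 * (((n - #A : ℕ) : ℝ) * (2 : ℝ)⁻¹ ^ #T)) → n ≤ (#A + 1 - t) * M → (#A + 1 - t) ^ t * (n ^ M) ^ t ≤ #((Finset.univ : Finset (Fin t → Fin M → Fin n)).filter fun c => ∃ T ⊆ A, Summit.PneNP.PneNP.Theorems.MonotoneSuffices.Greedy.run (Literature.Probability.RandomGraphs.PlantedClique.plant A z) c t = some T) * ∏ i ∈ Finset.range t, (2 * (#A + 2 * n / 2 ^ i)) :=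
  fun A z t M hgood hM => card_runsInto_ge_of_good A z t M hgood hM

end Summit.PneNP.PneNP.Theorems.MonotoneSuffices.Greedy
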